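import Summits.BirchSwinnertonDyer.BirchSwinnertonDyer.Theorems.KolyvaginRankRigidityAtTwoChebotarevPairAtTwo
import Summits.BirchSwinnertonDyer.BirchSwinnertonDyer.Theorems.KolyvaginRankRigidityAtTwoOffHabitatIrredChebotarevOneClassFiniteIndex
import HarnessLib

/-!
# Route `KolyvaginRankRigidityAtTwo`, residual crux R_irr `OffHabitatIrredNonSurjTwoConverse`
# (stmt-BirchSwinnertonDyer-27123, LINE 8∞): ČEBOTAREV AT `2` FOR TWO EIGENCLASSES AT FINITE `2`-ADIC INDEX
# (helper, PROVED, unconditional; width seat `bsd-line-krr2-p2` g9)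

The window-replacement step of the KRR swap engine (`exists_kolyvaginPrime_notMem_pair_frob` →
`…SwapFromPiecesCoreFrobNine`) needs ONE Kolyvagin prime seeing TWO eigenclasses (McCallum 1991, proof of
Prop. 5.2; at `2` no eigen-separation: a group is not the union of two proper subgroups). The habitat theorem
`exists_kolyvaginPrime_gt_two_eigenclass_pair_of_le` uses the `2`-adic image only through Step B′
(`exists_mem_torsionFixing_eigenvalue_large`: `-1 ∈ ρ(Γ_K)` + simplicity of `E[2]`). This file is the same proof
with Step B′ replaced by the finite-index Step B′ `exists_mem_torsionFixing_eigenvalue_large_of_inflationDefect`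
(p647123): hypotheses `hSah` (inflation defect `≤ k` bits, e.g. `inflationDefect_of_serre`, p648454) and `hS`
(`E[2]` simple over `K`, e.g. `simple_two_of_torsionBy_eq_bot`, p647473); conclusion with `j + k + 2 ≤ m_i`
(loss `k + 1` bits) instead of `j + 3 ≤ m_i`. Result: `exists_kolyvaginPrime_gt_two_eigenclass_pair_of_inflationDefect`.

HONEST FRAMING: helper (`--supports` 27123) for the re-threading of V2irr / U2irr (LINE 8∞); nothing here closes
R_irr; BSD is NOT proved by any of this.

References: [McCallumLMS1991] §5 (proof of Prop. 5.2), §3 Cor. 3.2; [Kolyvagin1991MathAnn] §2 (ref. [1] Prop. 8);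
[Sah1968] Prop. 2.7 (b).
-/

set_option autoImplicit false
-- the Theorems namespace of this sub repeats the summit name by design (D-0017 nested layout)
set_option linter.dupNamespace false

noncomputable section

open scoped Classical Pointwise

namespace Summit.BirchSwinnertonDyer.BirchSwinnertonDyer.Theorems.KolyvaginLowerBoundAtTwo

open WeierstrassCurve Field NumberField IsDedekindDomain
open Literature.NumberTheory.GaloisRepresentations Literature.NumberTheory.EllipticCurves
open Literature.NumberTheory Rat.HeightOneSpectrum

universe u

section Pair

variable {W : WeierstrassCurve ℚ}

set_option maxHeartbeats 800000 in
/-- **Čebotarev at `2` for TWO eigenclasses simultaneously, one level up, AT FINITE `2`-ADIC INDEX** — the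
habitat theorem `exists_kolyvaginPrime_gt_two_eigenclass_pair_of_le` with the two image inputs replaced by
`hSah` (inflation defect `≤ k` bits) and `hS` (`E[2]` simple); loss `k + 1` bits per class (the shape used in
Kolyvagin's window replacement, McCallum's proof of Prop. 5.2: one prime `ℓ'` with
`φ_{Frob}(c(n)) ≠ 0` AND `φ_{Frob}(c) ≠ 0` for an auxiliary class `c`; at odd `p` this uses that the
two classes lie in different eigenspaces, at `2` NO independence or eigen-separation is needed —
a group is not the union of two proper subgroups). For `κ₁, κ₂ ∈ H¹(K, E[2^M])`, `c_* κ_i = ε_i κ_i`,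
`2^{m_i - 1} κ_i ≠ 0`, `M ≤ M'`: above every bound a Kolyvagin prime `ℓ` at `2` with `M' ≤ M(ℓ)` at
whose place BOTH `2^j κ₁` (`j + k + 2 ≤ m₁`) and `2^j κ₂` (`j + k + 2 ≤ m₂`) are not locally trivial.
[cite: McCallumLMS1991, §5 (proof of Prop. 5.2), §3 Cor. 3.2] [cite: Kolyvagin1991MathAnn, §2
(ref. [1] Prop. 8)] -/
theorem exists_kolyvaginPrime_gt_two_eigenclass_pair_of_inflationDefect {N : ℕ} [NeZero N]
    [W.IsElliptic] [W.IsGloballyMinimal] {K : Type} [Field K] [NumberField K]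
    (hK : IsImaginaryQuadratic K)
    (hS : ∀ H : AddSubgroup (geomTorsion (W.baseChange K) 2),
      (∀ g : absoluteGaloisGroup K, ∀ t ∈ H, g • t ∈ H) → H = ⊥ ∨ H = ⊤)
    {c : K ≃ₐ[ℚ] K} (hc : c ≠ 1) {M M' : ℕ} (hM : 1 ≤ M) (hMM' : M ≤ M') {k : ℕ}
    (hSah : ∀ x : galH1Torsion (W.baseChange K) ((2 ^ M : ℕ) : ℤ),
      (∀ g ∈ torsionFixing (W.baseChange K) ((2 ^ M' : ℕ) : ℤ),
        h1Eval (W.baseChange K) ((2 ^ M : ℕ) : ℤ) x g = 0) → (2 : ℤ) ^ k • x = 0)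
    (κ₁ κ₂ : galH1Torsion (W.baseChange K) ((2 ^ M : ℕ) : ℤ))
    {ε₁ ε₂ : ℤ} (hε₁ : ε₁ = 1 ∨ ε₁ = -1) (hε₂ : ε₂ = 1 ∨ ε₂ = -1)
    (hκ₁ : conjAct W c ((2 ^ M : ℕ) : ℤ) κ₁ = ε₁ • κ₁)
    (hκ₂ : conjAct W c ((2 ^ M : ℕ) : ℤ) κ₂ = ε₂ • κ₂)
    {m₁ m₂ : ℕ} (hm₁ : (2 : ℤ) ^ (m₁ - 1) • κ₁ ≠ 0) (hm₂ : (2 : ℤ) ^ (m₂ - 1) • κ₂ ≠ 0) (b : ℕ) :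
    ∃ ℓ : ℕ, b < ℓ ∧ Zhang2014.IsKolyvaginPrime N W K 2 ℓ ∧ M' ≤ Zhang2014.kolyvaginIndex W 2 ℓ ∧
      FrobEqFrobInfty W K (2 ^ M') ℓ ∧
      ∀ v : HeightOneSpectrum (𝓞 K), (ℓ : 𝓞 K) ∈ v.asIdeal →
        (∀ j : ℕ, j + k + 2 ≤ m₁ → ((2 ^ j : ℕ) : ℤ) • κ₁ ∉
          (W.baseChange K).torsionLocalKer (v.adicCompletion K) ((2 ^ M : ℕ) : ℤ)) ∧
        (∀ j : ℕ, j + k + 2 ≤ m₂ → ((2 ^ j : ℕ) : ℤ) • κ₂ ∉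
          (W.baseChange K).torsionLocalKer (v.adicCompletion K) ((2 ^ M : ℕ) : ℤ)) := by
  classical
  have hp : Nat.Prime 2 := Nat.prime_two
  haveI : Fact (Nat.Prime 2) := ⟨hp⟩
  have hM' : 1 ≤ M' := hM.trans hMM'
  have hdvdMM' : ((2 ^ M : ℕ) : ℤ) ∣ ((2 ^ M' : ℕ) : ℤ) := by exact_mod_cast Nat.pow_dvd_pow 2 hMM'
  have hle := torsionFixing_le_of_dvd (W.baseChange K) hdvdMM'
  obtain ⟨c₀, hc₀⟩ := exists_isComplexConjugation (Rat.castHom ℝ)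
  have ht : IsLiftOfAut c (absGaloisTransport (K := ℚ) (L := K) c₀).toRingEquiv :=
    RatClosure.isLiftOfAut_absGaloisTransport_of_isImaginaryQuadratic hK hc hc₀
  have hinv : ∀ x, (absGaloisTransport (K := ℚ) (L := K) c₀).toRingEquiv
      ((absGaloisTransport (K := ℚ) (L := K) c₀).toRingEquiv x) = x := fun x ↦
    RatClosure.absGaloisTransport_absGaloisTransport_of_sq_eq_one hc₀.sq_eq_one x
  set G := torsionFixing (W.baseChange K) ((2 ^ M' : ℕ) : ℤ) with hG
  -- the "bad" subgroups `Z_i = {g : 2^{m_i - k - 2}(ε_i τ[κ_i, g] + [κ_i, g]) = 0}` of `Γ_{K(E[2^M])}`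
  have hZ : ∀ (κ : galH1Torsion (W.baseChange K) ((2 ^ M : ℕ) : ℤ)) (ε : ℤ) (k : ℕ),
      ∃ Z : Subgroup (absoluteGaloisGroup K), ∀ g ∈ torsionFixing (W.baseChange K) ((2 ^ M : ℕ) : ℤ),
        g ∈ Z ↔ (2 : ℤ) ^ k • (ε • ht.torsionMap W ((2 ^ M : ℕ) : ℤ) (h1Eval (W.baseChange K) ((2 ^ M : ℕ) : ℤ) κ g) +
          h1Eval (W.baseChange K) ((2 ^ M : ℕ) : ℤ) κ g) = 0 := by
    intro κ ε k
    -- the homomorphism `g ↦ 2^k (ε τ[κ,g] + [κ,g])` on `Γ_{K(E[2^M])}`, extended by junk outside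
    let f : absoluteGaloisGroup K → geomTorsion (W.baseChange K) ((2 ^ M : ℕ) : ℤ) := fun g ↦
      (2 : ℤ) ^ k • (ε • ht.torsionMap W ((2 ^ M : ℕ) : ℤ) (h1Eval (W.baseChange K) ((2 ^ M : ℕ) : ℤ) κ g) +
        h1Eval (W.baseChange K) ((2 ^ M : ℕ) : ℤ) κ g)
    have hf_mul : ∀ g₁ ∈ torsionFixing (W.baseChange K) ((2 ^ M : ℕ) : ℤ), ∀ g₂, f (g₁ * g₂) = f g₁ + f g₂ := by
      intro g₁ hg₁ g₂
      simp only [f, h1Eval_mul _ _ κ hg₁ g₂, map_add, smul_add]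
      abel
    have hf_one : f 1 = 0 := by simp only [f, h1Eval_one, map_zero, smul_zero, add_zero]
    refine ⟨{ carrier := {g | g ∈ torsionFixing (W.baseChange K) ((2 ^ M : ℕ) : ℤ) ∧ f g = 0}
              mul_mem' := fun {a b} ha hb ↦ ⟨mul_mem ha.1 hb.1, by rw [hf_mul a ha.1 b, ha.2, hb.2, add_zero]⟩
              one_mem' := ⟨Subgroup.one_mem _, hf_one⟩
              inv_mem' := fun {a} ha ↦ ⟨inv_mem ha.1, by
                have h := hf_mul a ha.1 a⁻¹
                rw [mul_inv_cancel, hf_one, ha.2, zero_add] at h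
                exact h.symm⟩ }, fun g hg ↦ ⟨fun h ↦ h.2, fun h ↦ ⟨hg, h⟩⟩⟩
  obtain ⟨Z₁, hZ₁⟩ := hZ κ₁ ε₁ (m₁ - (k + 2))
  obtain ⟨Z₂, hZ₂⟩ := hZ κ₂ ε₂ (m₂ - (k + 2))
  -- Step B′ for each class gives an element of `G` outside `Z_i` (when `m_i ≥ 3`)
  have hout : ∀ (κ : galH1Torsion (W.baseChange K) ((2 ^ M : ℕ) : ℤ)) (ε : ℤ) (hε : ε = 1 ∨ ε = -1)
      (hκ : conjAct W c ((2 ^ M : ℕ) : ℤ) κ = ε • κ) (m : ℕ) (hm : (2 : ℤ) ^ (m - 1) • κ ≠ 0)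
      (Z : Subgroup (absoluteGaloisGroup K)),
      (∀ g ∈ torsionFixing (W.baseChange K) ((2 ^ M : ℕ) : ℤ), g ∈ Z ↔ (2 : ℤ) ^ (m - (k + 2)) •
        (ε • ht.torsionMap W ((2 ^ M : ℕ) : ℤ) (h1Eval (W.baseChange K) ((2 ^ M : ℕ) : ℤ) κ g) + h1Eval (W.baseChange K) ((2 ^ M : ℕ) : ℤ) κ g) = 0) →
      k + 2 ≤ m → ∃ g ∈ G, g ∉ Z := by
    intro κ ε hε hκ m hm Z hZ hm3
    obtain ⟨ρ, hρT, hρv⟩ :=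
      exists_mem_torsionFixing_eigenvalue_large_of_inflationDefect hS hc₀ ht hMM' hSah κ hε hm
    exact ⟨ρ, hρT, fun h ↦ hρv (m - (k + 2)) (by omega) ((hZ ρ (hle hρT)).mp h)⟩
  -- choose `ρ ∈ G` outside the relevant `Z_i`
  have hρex : ∃ ρ ∈ G, (k + 2 ≤ m₁ → ρ ∉ Z₁) ∧ (k + 2 ≤ m₂ → ρ ∉ Z₂) := by
    by_cases h1 : k + 2 ≤ m₁
    · by_cases h2 : k + 2 ≤ m₂
      · obtain ⟨g, hgG, hg1, hg2⟩ := exists_not_mem_and_not_mem (H := G)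
          (hout κ₁ ε₁ hε₁ hκ₁ m₁ hm₁ Z₁ hZ₁ h1) (hout κ₂ ε₂ hε₂ hκ₂ m₂ hm₂ Z₂ hZ₂ h2)
        exact ⟨g, hgG, fun _ ↦ hg1, fun _ ↦ hg2⟩
      · obtain ⟨g, hgG, hg1⟩ := hout κ₁ ε₁ hε₁ hκ₁ m₁ hm₁ Z₁ hZ₁ h1
        exact ⟨g, hgG, fun _ ↦ hg1, fun h ↦ absurd h h2⟩
    · by_cases h2 : k + 2 ≤ m₂
      · obtain ⟨g, hgG, hg2⟩ := hout κ₂ ε₂ hε₂ hκ₂ m₂ hm₂ Z₂ hZ₂ h2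
        exact ⟨g, hgG, fun h ↦ absurd h h1, fun _ ↦ hg2⟩
      · exact ⟨1, Subgroup.one_mem _, fun h ↦ absurd h h1, fun h ↦ absurd h h2⟩
  obtain ⟨ρ, hρT, hρ1, hρ2⟩ := hρex
  -- ### Steps C–G with the family `(κ₁, κ₂)`
  obtain ⟨B₀, hB₀⟩ := exists_gt_hasGoodReductionAt W
  obtain ⟨ℓ, hbℓ, hℓ, hℓN, hℓD, hℓ2, hprime, h32, g, hg, hgT', hloc⟩ :=
    exists_kolyvaginPrime_gt_of_galoisElement_of_le (W := W) (N := N)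
      Automorphic.chebotarev_artinRep_of_galoisSide hK hp hMM' hc₀ ht hinv ![κ₁, κ₂] hρT (max b B₀)
  have hbℓ' : b < ℓ := lt_of_le_of_lt (le_max_left _ _) hbℓ
  have hidx : M' ≤ Zhang2014.kolyvaginIndex W 2 ℓ :=
    le_kolyvaginIndex_of_frobEqFrobInfty hM' hℓ hℓ2 h32
      (hB₀ ℓ hℓ (lt_of_le_of_lt (le_max_right _ _) hbℓ))
  have hkoly : Zhang2014.IsKolyvaginPrime N W K 2 ℓ :=
    ⟨hℓ, hℓN, hℓD, hℓ2, hprime, lt_of_lt_of_le (by omega) hidx⟩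
  have hρg : ρ * g ∈ G := mul_mem hρT hgT'
  have hF : ht.conjGalCMH (ρ * g) * (ρ * g) ∈ torsionFixing (W.baseChange K) ((2 ^ M : ℕ) : ℤ) :=
    mul_mem (ht.conjGalCMH_mem_torsionFixing W hinv _ (hle hρg)) (hle hρg)
  have hcl : ∀ (i : Fin 2) (j : ℕ), ((2 ^ j : ℕ) : ℤ) • ![κ₁, κ₂] i ∈
      AddSubgroup.closure (Set.range ![κ₁, κ₂]) := fun i j ↦
    AddSubgroup.zsmul_mem _ (AddSubgroup.subset_closure (Set.mem_range.mpr ⟨i, rfl⟩)) _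
  -- the local statement for each class
  have key : ∀ (i : Fin 2) (ε : ℤ) (hε : ε = 1 ∨ ε = -1) (hκ : conjAct W c ((2 ^ M : ℕ) : ℤ) (![κ₁, κ₂] i) = ε • ![κ₁, κ₂] i)
      (m : ℕ) (Z : Subgroup (absoluteGaloisGroup K)),
      (∀ g ∈ torsionFixing (W.baseChange K) ((2 ^ M : ℕ) : ℤ), g ∈ Z ↔ (2 : ℤ) ^ (m - (k + 2)) •
        (ε • ht.torsionMap W ((2 ^ M : ℕ) : ℤ) (h1Eval (W.baseChange K) ((2 ^ M : ℕ) : ℤ) (![κ₁, κ₂] i) g) +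
          h1Eval (W.baseChange K) ((2 ^ M : ℕ) : ℤ) (![κ₁, κ₂] i) g) = 0) →
      (k + 2 ≤ m → ρ ∉ Z) →
      ∀ v : HeightOneSpectrum (𝓞 K), (ℓ : 𝓞 K) ∈ v.asIdeal → ∀ j : ℕ, j + k + 2 ≤ m →
        ((2 ^ j : ℕ) : ℤ) • ![κ₁, κ₂] i ∉
          (W.baseChange K).torsionLocalKer (v.adicCompletion K) ((2 ^ M : ℕ) : ℤ) := by
    intro i ε hε hκ m Z hZ hρZ v hv j hj hmem
    have h0 := (hloc _ (hcl i j) v hv).mp hmem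
    rw [h1Eval_zsmul _ _ _ _ hF,
      h1Eval_conjGalCMH_mul_mul_of_eigen W ht hinv _ hε hκ (hle hρT) (hle hgT') (hg.2 i)] at h0
    apply hρZ (by omega)
    rw [hZ ρ (hle hρT)]
    have e : m - (k + 2) = (m - (k + 2) - j) + j := by omega
    rw [e, pow_add, mul_smul]
    have h0' : (2 : ℤ) ^ j • (ε • ht.torsionMap W ((2 ^ M : ℕ) : ℤ) (h1Eval (W.baseChange K) ((2 ^ M : ℕ) : ℤ) (![κ₁, κ₂] i) ρ) +
        h1Eval (W.baseChange K) ((2 ^ M : ℕ) : ℤ) (![κ₁, κ₂] i) ρ) = 0 := by exact_mod_cast h0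
    rw [h0', smul_zero]
  refine ⟨ℓ, hbℓ', hkoly, hidx, h32, fun v hv ↦ ⟨?_, ?_⟩⟩
  · exact key 0 ε₁ hε₁ hκ₁ m₁ Z₁ hZ₁ hρ1 v hv
  · exact key 1 ε₂ hε₂ hκ₂ m₂ Z₂ hZ₂ hρ2 v hv


end Pair

end Summit.BirchSwinnertonDyer.BirchSwinnertonDyer.Theorems.KolyvaginLowerBoundAtTwo

end
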